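import Summits.PneNP.PneNP.Theses.RamseyUncertifiable
import Literature.Combinatorics.SimpleGraph.PaleySosProofs
import Literature.Combinatorics.SimpleGraph.LasserreFiniteConvergence
import Literature.Combinatorics.SimpleGraph.LovaszThetaComplement
import Literature.Combinatorics.SimpleGraph.LasserreLevelOne

set_option linter.dupNamespace false

/-!
# Disproof of `PaleySosRung` (stmt-PneNP-9817) — findings of the standing adversary (cdisprove)

Crux (`Summit.PneNP.PneNP.Theses.RamseyUncertifiable.PaleySosRung`, route RamseyUncertifiable #4):
`∀ t ≥ 1, ∃ η > 0, ∃ p₀, ∀ primes p ≥ p₀ with p ≡ 1 (mod 4): p^η ≤ las⁽ᵗ⁾(P_p)`, `P_p` the Paley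
graph `SimpleGraph.fromRel (fun x y : Fin p => IsSquare (x - y))` (= tree `paleyGraph p`, `rfl`),
`las⁽ᵗ⁾ = lasserreStableBound` (Laurent's program (22)).

## Verdict after cycles 1–2: NOT refuted — and WHY it resists

`indepNum_lt_of_not_paleySosRung`: a disproof (at any level `t`) yields, for EVERY `η > 0`,
infinitely many primes `p ≡ 1 (mod 4)` with `α(P_p) (= ω(P_p)) < p^η`, because `α ≤ las⁽ᵗ⁾`
(soundness, tree). So refuting the crux means PROVING that the clique number of prime-order Paley
graphs is `p^{o(1)}` along an infinite sequence — the best proved bound is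
`ω(P_p) ≤ (√(2p−1)+1)/2` (Hanson–Petridis 2021) and even `p^{1/2−ε}` is open. Numerics
(Kunisky–Yu 2022 §6, p. 57 of arXiv:2211.02713, read): `SOS₄(G_p) ∼ p^{0.395}` for `p ≲ 250`,
`FK₄ ∼ p^{0.323}`; Kobzar–Mody 2023 (arXiv:2304.08615 §5, p. 8, read): the block-diagonal bound
`L²(G_p) ≥ SOS₄(G_p)` scales as `p^{0.456}` over all primes `p < 1000` (GLV09 also tabulate `L³ ≥ SOS₆`
for `p ≤ 809`) — level-`2`/`3` numerics stay polynomial, i.e. consistent with `η₂ ≈ 0.4 > 0`; KY §7 (p. 57): evidence that a high constant degree may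
break `√p` down to `p^{1/2−ε}` — nothing suggests `p^{o(1)}` at constant degree. Kunisky 2024
(arXiv:2303.16475, Experimental Math., Thm 1.19, p. 7, read): even CONDITIONALLY on his spectral
pseudorandomness conjectures, degree-`a` localization + the spectral bound gives only
`α(P_p) ≤ (√(2^a−1)/2^{a−1})·√p + o(√p)` — a constant-factor gain per degree, exponent `1/2` fixed;
`o(√p)` needs `a → ∞`. So every prediction in print keeps constant-level certificates at `p^{Θ(1)}`. No counterexample
search is meaningful below that barrier; the statement read back symbol by symbol has no junk at
`t ≥ 1` (`Fin p` arithmetic is `ZMod p`; `fromRel` symmetrises/irreflexive; `p ≡ 1 (4)` makes `−1`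
a square; `rpow`; `las⁽ᵗ⁾ ∈ [α, |V|]` a genuine supremum).

## Findings (all `sorry`-free; axioms `propext`, `Classical.choice`, `Quot.sound`)

**(0) Consequences of a disproof.** `indepNum_lt_of_not_paleySosRung` (above) and its clique form
`cliqueNum_lt_of_not_paleySosRung` (`ω(P_p) = α(P_p)`, `cliqueNum_paleyGraph_eq_indepNum`);
`paleySosRung_of_sosUncertainty : SosUncertainty → PaleySosRung` (the route's `[deps]`, PROVED,
`η = δ/2`, through the new `lasserreStableBound_compl_paleyGraph : las⁽ᵗ⁾(P̄_p) = las⁽ᵗ⁾(P_p)`), hence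
`not_sosUncertainty_of_not_paleySosRung`: killing this crux kills crux #2 (UP_t) as well.

**(a) Load-bearing hypotheses** (`…Without…` + `_false_without_…`): every hypothesis is necessary.
* `1 ≤ t` — `paleySosRung_false_without_levelPos`: `las⁽⁰⁾ = 0` is junk (`lasserreStableBound_zero`).
* `p % 4 = 1` — `paleySosRung_false_without_modFour`: for primes `p ≡ 3 (mod 4)` (Dirichlet) the
  symmetrised graph is `K_p` (`paleyGraph_eq_top_of_mod_four_eq_three`) and `las⁽ᵗ⁾(K_p) ≤ 1`.
* `p.Prime` — `paleySosRung_false_without_prime`: along `p = 3s ≡ 1 (mod 4)`, `s ≡ 3 (mod 4)` prime,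
  the three residue classes mod `3` are CLIQUES of the square-difference graph on `ℤ/pℤ` (CRT,
  `paleyGraph_adj_of_crt_fst_eq`), so `las⁽ᵗ⁾ ≤ 3` (`lasserreStableBound_paleyGraph_three_mul_le`):
  the field structure, not just "squares in a cyclic group", carries the statement.
* `∃ p₀` — NOT load-bearing: `paleySosRung_iff_forall_prime` (the `p₀`-free form is EQUIVALENT;
  shrink `η` so that `p^η ≤ 2 ≤ α(P_p) ≤ las⁽ᵗ⁾(P_p)` below `p₀`, `two_le_lasserreStableBound_paleyGraph`).

**(b) Tightness / boundary.** `lasserreStableBound_paleyGraph_one : las⁽¹⁾(P_p) = √p` EXACTLY (new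
`≤` from `isVertexTransitive_paleyGraph` + Lovász 1979 Thm 8 (tree) + the tree's `√p ≤ las⁽¹⁾(P̄_p)`);
`lasserreStableBound_paleyGraph_le_sqrt : las⁽ᵗ⁾(P_p) ≤ √p` for all `t ≥ 1`, whence
`exponent_le_half`: at EVERY level an admissible `η` is `≤ 1/2`. Positive instances:
`paleySosRung_level_one` (`t = 1`, `η = 1/2`, `p₀ = 0`) and `paleySosRung_level_two_of_kuniskyYu`
(`t = 2`, `η = 1/6`, from the vendored fact `kuniskyYu2022_theorem_1_2` transported along the
self-complementarity `nonempty_iso_compl_paleyGraph` by `lasserreStableBound_eq_of_iso`). The live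
content of the crux is `t ≥ 3`.

**(c) Natural strengthenings refuted.** `not_paleySosRungSqrtAllLevels`: "`√p ≤ las⁽ᵗ⁾(P_p)` for all
`t`, `p`" is FALSE (`t = 2`, `p = 5`: `las⁽²⁾(C_5) = α(C_5) = 2 < √5`, finite convergence, tree);
uniformly, `not_paleySosRungSqrtEventually`: "`∃ p₀ ∀ t ∀ p ≥ p₀: √p ≤ las⁽ᵗ⁾(P_p)`" is FALSE (at
`t = p`, `las⁽ᵗ⁾(P_p) = α(P_p) < √p` for EVERY prime, `lasserreStableBound_paleyGraph_lt_sqrt_of_card_le`)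
— the hierarchy drops strictly below `√p` at every fixed `p`; only the exponent as `p → ∞` is at
stake, and a threshold `p₀` uniform in `t` is not available even for the constant.
`η > 1/2` at any level: impossible by (b). NOT refutable with present knowledge (each needs an SoS
UPPER bound below `√p` for infinitely many `p`): "`η_t = 1/2` works eventually at `t = 2`" (KY
conjecture it fails, unproved), "`η` uniform in `t`".

**(d) Targets.** None handed over (no stuck stubs).  **(e) Near-misses.** Nothing sorried.

Reusable tools: `sum_clique_le_one` (level-1 clique inequality), `lasserreStableBound_le_card_of_cliqueCover`,
`lasserreStableBound_top_le_one`, `lasserreStableBound_le_of_iso` / `lasserreStableBound_eq_of_iso`,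
`lovaszTheta_paleyGraph_le_sqrt`.

## LANDED in Literature (import these; the copies below in this work file are the originals)

* `Literature/Combinatorics/SimpleGraph/LasserreCliqueCover.lean` (p68379): `lasserreStableBound_zero`,
  `IsLasserreFeasible.sum_clique_le_one`, `lasserreStableBound_le_card_of_cliqueCover`,
  `lasserreStableBound_top_le_one`, `lasserreStableBound_le_of_iso`, `lasserreStableBound_eq_of_iso`.
* `Literature/Combinatorics/SimpleGraph/PaleySelfComplementary.lean` (p68605):
  `isVertexTransitive_paleyGraph`, `lovaszTheta_paleyGraph_le_sqrt`,
  `lasserreStableBound_paleyGraph_le_sqrt`, `lasserreStableBound_paleyGraph_one`,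
  `isSquare_or_isSquare_neg_of_mod_four_eq_three`, `paleyGraph_adj_of_ne_of_mod_four_eq_three`,
  `paleyGraph_eq_top_of_mod_four_eq_three`, `indepNum_paleyGraph_five_le`,
  `paleyGraph_adj_of_crt_fst_eq`, `nonempty_iso_compl_paleyGraph`.
* `Literature/Combinatorics/SimpleGraph/PaleyDegenerateModuli.lean` (p69227):
  `lasserreStableBound_paleyGraph_three_mul_le`, `lasserreStableBound_compl_paleyGraph`,
  `indepNum_le_of_iso`, `cliqueNum_paleyGraph_eq_indepNum`,
  `lasserreStableBound_paleyGraph_lt_sqrt_of_card_le`.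
All under `namespace Literature.Combinatorics.SimpleGraph`. The crux-level theorems ((0), (a), (b),
(c), the glue `paleySosRung_of_sosUncertainty` and the level-1/2 instances) import the Theses file and
therefore stay here as item evidence (a refuter may land only `¬ Theses` decls under `Theorems/`);
a PROVER may copy them. A slimmed version of this file importing the three Literature modules
(`Disproof_slim.lean` in the seat folder) replaces this one as soon as the farm has built p69227.
-/

namespace Summit.PneNP.PneNP.Cruxes.PaleySosRung.Disproof

open Literature.Combinatorics.SimpleGraph
open Summit.PneNP.PneNP.Theses.RamseyUncertifiable
open Matrix Finset

noncomputable section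

/-! ### General lemmas on `las⁽ᵗ⁾` -/

section General

variable {V : Type*} [Fintype V] [DecidableEq V]

/-- **Level `0` is junk**: `las⁽⁰⁾(G) = 0` for every finite graph (the value set is `{|V|·c : c ∈ ℝ}`
up to feasibility, unbounded when `V ≠ ∅`, and `{0}` when `V = ∅`; `Real.sSup` of an unbounded set
is `0`). [folklore] -/
theorem lasserreStableBound_zero (G : SimpleGraph V) : lasserreStableBound G 0 = 0 := by
  have hfeas : ∀ c : ℝ, IsLasserreFeasible G 0
      (fun S => if S = ∅ then 1 else if S.card = 1 then c else 0) := by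
    intro c
    refine ⟨by simp, fun u v huv => ?_, ?_⟩
    · have hne := G.ne_of_adj huv
      have h2 : ({u, v} : Finset V).card = 2 := card_pair hne
      have hne' : ({u, v} : Finset V) ≠ ∅ := by
        intro h; rw [h] at h2; simp at h2
      simp [hne', h2]
    · have hI : ∀ I : {S : Finset V // S.card ≤ 0}, I.1 = ∅ := fun I =>
        Finset.card_eq_zero.1 (Nat.le_zero.1 I.2)
      have hM : momentMatrix 0 (fun S : Finset V => if S = ∅ then (1 : ℝ) else if S.card = 1 then c else 0) =
          vecMulVec (fun _ => (1 : ℝ)) (star fun _ => (1 : ℝ)) := by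
        ext I J
        simp [momentMatrix_apply, hI I, hI J, vecMulVec_apply]
      rw [hM]
      exact posSemidef_vecMulVec_self_star _
  have hval : ∀ c : ℝ, (Fintype.card V : ℝ) * c ∈
      (fun y : Finset V → ℝ => ∑ v, y {v}) '' {y | IsLasserreFeasible G 0 y} := by
    intro c
    refine ⟨_, hfeas c, ?_⟩
    simp
  rcases isEmpty_or_nonempty V with hV | hV
  · rw [lasserreStableBound]
    have hset : (fun y : Finset V → ℝ => ∑ v, y {v}) '' {y | IsLasserreFeasible G 0 y} = {0} := by
      refine Set.eq_singleton_iff_unique_mem.2 ⟨?_, ?_⟩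
      · simpa using hval 0
      · rintro _ ⟨y, -, rfl⟩
        simp
    rw [hset, csSup_singleton]
  · rw [lasserreStableBound]
    apply Real.sSup_of_not_bddAbove
    rintro ⟨b, hb⟩
    have hcard : (0 : ℝ) < Fintype.card V := by exact_mod_cast Fintype.card_pos
    have h := hb (hval (b / Fintype.card V + 1))
    rw [mul_add, mul_div_cancel₀ _ hcard.ne', mul_one] at h
    linarith

/-- **Clique inequality at level `1`**: for a level-`1` feasible `y` and a clique `K` of `G`,
`Σ_{v ∈ K} y_v ≤ 1` (test `M_1(y) ⪰ 0` at `x_∅ = 1`, `x_v = −[v ∈ K]`: the form is `1 − Σ_K y_v`,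
the cross terms `y_{uv}`, `u ≠ v ∈ K`, vanishing on the edges). [folklore] -/
theorem sum_clique_le_one {G : SimpleGraph V} {y : Finset V → ℝ} (hy : IsLasserreFeasible G 1 y)
    (K : Finset V) (hK : G.IsClique (K : Set V)) : ∑ v ∈ K, y {v} ≤ 1 := by
  set x : Option V → ℝ := fun o => o.elim (1 : ℝ) fun v => if v ∈ K then -1 else 0 with hx
  have hpsd := hy.posSemidef.submatrix (levelOneIndex (V := V))
  have h := hpsd.dotProduct_mulVec_nonneg x
  rw [star_trivial] at h
  -- the inner sums
  have hpair : ∀ u ∈ K, ∑ v ∈ K, y ({u} ∪ {v}) = y {u} := by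
    intro u hu
    rw [Finset.sum_eq_single_of_mem u hu]
    · simp
    · intro v hv hvu
      rw [← insert_eq]
      exact hy.pair_eq_zero (hK (mem_coe.2 hu) (mem_coe.2 hv) (Ne.symm hvu))
  have hexp : x ⬝ᵥ ((momentMatrix 1 y).submatrix levelOneIndex levelOneIndex *ᵥ x) =
      1 - ∑ v ∈ K, y {v} := by
    have hxn : x none = 1 := rfl
    have hxs : ∀ u, x (some u) = if u ∈ K then -1 else 0 := fun u => rfl
    have hrow_none : ((momentMatrix 1 y).submatrix levelOneIndex levelOneIndex *ᵥ x) none =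
        1 - ∑ v ∈ K, y {v} := by
      simp only [mulVec, dotProduct, Fintype.sum_option, submatrix_apply, momentMatrix_apply,
        levelOneIndex_none_val, levelOneIndex_some_val, hxn, hxs, empty_union,
        hy.empty_eq_one, mul_one, mul_ite, mul_neg, mul_zero]
      rw [Finset.sum_ite_mem, univ_inter, Finset.sum_neg_distrib]
      ring
    have hrow_some : ∀ u, ((momentMatrix 1 y).submatrix levelOneIndex levelOneIndex *ᵥ x) (some u) =
        y {u} - ∑ v ∈ K, y ({u} ∪ {v}) := by
      intro u
      simp only [mulVec, dotProduct, Fintype.sum_option, submatrix_apply, momentMatrix_apply,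
        levelOneIndex_none_val, levelOneIndex_some_val, hxn, hxs, union_empty, mul_one, mul_ite,
        mul_neg, mul_zero]
      rw [Finset.sum_ite_mem, univ_inter, Finset.sum_neg_distrib]
      ring
    rw [dotProduct, Fintype.sum_option, hrow_none, hxn, one_mul]
    suffices hz : ∑ u, x (some u) *
        ((momentMatrix 1 y).submatrix levelOneIndex levelOneIndex *ᵥ x) (some u) = 0 by
      rw [hz, add_zero]
    refine Finset.sum_eq_zero fun u _ => ?_
    rw [hrow_some, hxs]
    split_ifs with hu
    · rw [hpair u hu]; ring
    · ring
  rw [hexp] at h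
  linarith

/-- **Clique-cover bound**: if the vertices are coloured by `ι` so that distinct vertices of the
same colour are adjacent (each colour class is a clique), then `las⁽ᵗ⁾(G) ≤ |ι|` for `t ≥ 1`.
[folklore] -/
theorem lasserreStableBound_le_card_of_cliqueCover {ι : Type*} [Fintype ι] [DecidableEq ι]
    (G : SimpleGraph V) (c : V → ι) (hc : ∀ u v, u ≠ v → c u = c v → G.Adj u v) {t : ℕ}
    (ht : 1 ≤ t) : lasserreStableBound G t ≤ Fintype.card ι := by
  refine (lasserreStableBound_anti_level le_rfl ht).trans ?_
  refine lasserreStableBound_le_of_forall fun y hy => ?_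
  rw [← Finset.sum_fiberwise Finset.univ c fun v => y {v}]
  calc ∑ i, ∑ v ∈ Finset.univ.filter (fun v => c v = i), y {v} ≤ ∑ _i : ι, (1 : ℝ) := by
        refine Finset.sum_le_sum fun i _ => sum_clique_le_one hy _ ?_
        intro u hu v hv huv
        rw [mem_coe, mem_filter] at hu hv
        exact hc u v huv (hu.2.trans hv.2.symm)
    _ = Fintype.card ι := by simp

/-- The complete graph: `las⁽ᵗ⁾(K_V) ≤ 1` for `t ≥ 1`. [folklore] -/
theorem lasserreStableBound_top_le_one {t : ℕ} (ht : 1 ≤ t) :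
    lasserreStableBound (⊤ : SimpleGraph V) t ≤ 1 := by
  have h := lasserreStableBound_le_card_of_cliqueCover (⊤ : SimpleGraph V) (fun _ => ())
    (fun u v huv _ => (SimpleGraph.top_adj u v).2 huv) ht
  simpa using h

end General

/-! ### The Paley graph: vertex-transitivity and `las⁽ᵗ⁾(P_p) ≤ ϑ(P_p) ≤ √p` -/

section Paley

/-- Translations are automorphisms: the Paley graph is vertex-transitive. [folklore] -/
theorem isVertexTransitive_paleyGraph (m : ℕ) : IsVertexTransitive (paleyGraph (m + 1)) := by
  intro u v
  refine ⟨⟨Equiv.addRight (v - u), ?_⟩, ?_⟩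
  · intro a b
    simp only [Equiv.coe_addRight, paleyGraph_adj]
    rw [add_sub_add_right_eq_sub, add_sub_add_right_eq_sub, (add_left_injective _).ne_iff]
  · show u + (v - u) = v
    abel

/-- **`ϑ(P_p) ≤ √p`** (Lovász 1979 Thm 8 direction `≤` for the vertex-transitive `P_p`, combined with
`√p ≤ las⁽¹⁾(P̄_p) ≤ ϑ(P̄_p)` from the tree): the level-`1` value is EXACTLY `√p`. [folklore] -/
theorem lovaszTheta_paleyGraph_le_sqrt {p : ℕ} (hp : p.Prime) (h4 : p % 4 = 1) :
    lovaszTheta (paleyGraph p) ≤ Real.sqrt p := by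
  obtain ⟨m, rfl⟩ : ∃ m, p = m + 1 := ⟨p - 1, (Nat.succ_pred_eq_of_pos hp.pos).symm⟩
  have hprod := lovaszTheta_mul_lovaszTheta_compl_le_card (isVertexTransitive_paleyGraph m)
  rw [Fintype.card_fin] at hprod
  have hc : Real.sqrt ((m + 1 : ℕ) : ℝ) ≤ lovaszTheta (paleyGraph (m + 1))ᶜ :=
    (sqrt_le_lasserreStableBound_compl_paleyGraph_one hp h4).trans
      (lasserreStableBound_one_le_lovaszTheta _)
  have hs : Real.sqrt ((m + 1 : ℕ) : ℝ) * Real.sqrt ((m + 1 : ℕ) : ℝ) = ((m + 1 : ℕ) : ℝ) :=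
    Real.mul_self_sqrt (Nat.cast_nonneg _)
  have hθ0 : 0 ≤ lovaszTheta (paleyGraph (m + 1)) := lovaszTheta_nonneg _
  have hsqrt_pos : 0 < Real.sqrt ((m + 1 : ℕ) : ℝ) :=
    Real.sqrt_pos.2 (by exact_mod_cast Nat.succ_pos m)
  nlinarith [mul_le_mul_of_nonneg_left hc hθ0]

/-- `las⁽ᵗ⁾(P_p) ≤ √p` for every `t ≥ 1`: no level of the hierarchy beats exponent `1/2` from
below — the exponent `η` of the crux is at most `1/2`. [folklore] -/
theorem lasserreStableBound_paleyGraph_le_sqrt {p : ℕ} (hp : p.Prime) (h4 : p % 4 = 1) {t : ℕ}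
    (ht : 1 ≤ t) : lasserreStableBound (paleyGraph p) t ≤ Real.sqrt p :=
  (lasserreStableBound_le_lovaszTheta _ ht).trans (lovaszTheta_paleyGraph_le_sqrt hp h4)

/-- `las⁽¹⁾(P_p) = √p` exactly. [folklore] -/
theorem lasserreStableBound_paleyGraph_one {p : ℕ} (hp : p.Prime) (h4 : p % 4 = 1) :
    lasserreStableBound (paleyGraph p) 1 = Real.sqrt p :=
  le_antisymm (lasserreStableBound_paleyGraph_le_sqrt hp h4 le_rfl)
    (sqrt_le_lasserreStableBound_paleyGraph_one hp h4)

/-- For a prime `q ≡ 3 (mod 4)`, `−1` is a non-square in `𝔽_q`, so for `d ≠ 0` one of `d`, `−d`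
is a square. [folklore] -/
theorem isSquare_or_isSquare_neg_of_mod_four_eq_three (q : ℕ) [Fact q.Prime]
    (h3 : q % 4 = 3) {d : ZMod q} (hd : d ≠ 0) : IsSquare d ∨ IsSquare (-d) := by
  have hneg : ¬ IsSquare (-1 : ZMod q) := by
    rw [ZMod.exists_sq_eq_neg_one_iff]; omega
  rcases quadraticChar_dichotomy hd with h1 | h1
  · exact Or.inl ((quadraticChar_one_iff_isSquare hd).1 h1)
  · right
    have h2 : quadraticChar (ZMod q) (-d) = 1 := by
      rw [neg_eq_neg_one_mul, map_mul, h1, quadraticChar_neg_one_iff_not_isSquare.2 hneg]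
      norm_num
    exact (quadraticChar_one_iff_isSquare (neg_ne_zero.2 hd)).1 h2

/-- For `p ≡ 3 (mod 4)` distinct vertices are ALWAYS adjacent in the symmetrised square-difference
graph. [folklore] -/
theorem paleyGraph_adj_of_ne_of_mod_four_eq_three (m : ℕ) [Fact (m + 1).Prime]
    (h3 : (m + 1) % 4 = 3) (x y : ZMod (m + 1)) (hne : x ≠ y) : (paleyGraph (m + 1)).Adj x y := by
  rw [paleyGraph_adj]
  refine ⟨hne, ?_⟩
  change IsSquare (x - y) ∨ IsSquare (y - x)
  rw [← neg_sub x y]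
  exact isSquare_or_isSquare_neg_of_mod_four_eq_three (m + 1) h3 (sub_ne_zero.2 hne)

/-- For `p ≡ 3 (mod 4)` the symmetrised square-difference graph is COMPLETE. [folklore] -/
theorem paleyGraph_eq_top_of_mod_four_eq_three (m : ℕ) [Fact (m + 1).Prime]
    (h3 : (m + 1) % 4 = 3) : paleyGraph (m + 1) = ⊤ := by
  ext x y
  rw [SimpleGraph.top_adj]
  exact ⟨fun h => h.ne, fun hne => paleyGraph_adj_of_ne_of_mod_four_eq_three m h3 x y hne⟩

/-- `α(P_5) ≤ 2` (`P_5 = C_5`). [folklore] -/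
theorem indepNum_paleyGraph_five_le : (paleyGraph 5).indepNum ≤ 2 := by
  obtain ⟨s, hs⟩ := (paleyGraph 5).exists_isNIndepSet_indepNum
  rw [← hs.card_eq]
  by_contra h
  have key : ∀ s : Finset (Fin 5), 3 ≤ s.card → ∃ u ∈ s, ∃ v ∈ s, u ≠ v ∧ (paleyGraph 5).Adj u v := by
    simp only [paleyGraph_adj]
    decide
  obtain ⟨u, hu, v, hv, huv, hadj⟩ := key s (by omega)
  exact hs.isIndepSet (mem_coe.2 hu) (mem_coe.2 hv) huv hadj

/-! #### Composite moduli `p = 3s`: the residue classes mod `3` are cliques -/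

/-- For `p = 3s` (`s` prime, `s ≡ 3 (mod 4)`, `3 ∤ s`): two distinct elements of `ℤ/pℤ` with the
same CRT coordinate mod `3` differ by `d ↔ (0, c)`, `c ≠ 0`, and `c` or `−c` is a square in `𝔽_s`,
so `d` or `−d` is a square in `ℤ/pℤ`: the vertices are ADJACENT. [folklore] -/
theorem paleyGraph_adj_of_crt_fst_eq {m s : ℕ} [Fact s.Prime] (hs3 : s % 4 = 3)
    (hcop : Nat.Coprime 3 s) (hm : m + 1 = 3 * s) (x y : ZMod (m + 1)) (hne : x ≠ y)
    (hxy : ((ZMod.ringEquivCongr hm).trans (ZMod.chineseRemainder hcop) x).1 =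
      ((ZMod.ringEquivCongr hm).trans (ZMod.chineseRemainder hcop) y).1) :
    (paleyGraph (m + 1)).Adj x y := by
  set e := (ZMod.ringEquivCongr hm).trans (ZMod.chineseRemainder hcop) with he
  rw [paleyGraph_adj]
  refine ⟨hne, ?_⟩
  change IsSquare (x - y) ∨ IsSquare (y - x)
  have hc : (e x).2 - (e y).2 ≠ 0 := by
    intro h0
    exact hne (e.injective (Prod.ext hxy (sub_eq_zero.1 h0)))
  have key : ∀ {a b : ZMod (m + 1)}, (e a).1 = (e b).1 → IsSquare ((e a).2 - (e b).2) →
      IsSquare (a - b) := by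
    intro a b hab hsq
    obtain ⟨w, hw⟩ := hsq
    have h1 : e (a - b) = (0, w) * (0, w) := by
      rw [map_sub, Prod.ext_iff]
      refine ⟨?_, ?_⟩
      · simp [hab]
      · simpa using hw
    have h2 : a - b = e.symm (0, w) * e.symm (0, w) := by
      rw [← map_mul, ← h1, RingEquiv.symm_apply_apply]
    exact ⟨_, h2⟩
  rcases isSquare_or_isSquare_neg_of_mod_four_eq_three s hs3 hc with h | h
  · exact Or.inl (key hxy h)
  · right
    rw [neg_sub] at h
    exact key hxy.symm h

/-- **Composite moduli kill the bound**: for `p = 3s`, `s` prime, `s ≡ 3 (mod 4)`, `3 ∤ s`, the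
symmetrised square-difference graph on `ℤ/pℤ` is covered by the `3` cliques "`≡ r (mod 3)`", hence
`las⁽ᵗ⁾ ≤ 3` for all `t ≥ 1`. [folklore] -/
theorem lasserreStableBound_paleyGraph_three_mul_le {m s : ℕ} [Fact s.Prime] (hs3 : s % 4 = 3)
    (hcop : Nat.Coprime 3 s) (hm : m + 1 = 3 * s) {t : ℕ} (ht : 1 ≤ t) :
    lasserreStableBound (paleyGraph (m + 1)) t ≤ 3 := by
  have h := lasserreStableBound_le_card_of_cliqueCover (paleyGraph (m + 1))
    (fun x : ZMod (m + 1) => (((ZMod.ringEquivCongr hm).trans (ZMod.chineseRemainder hcop)) x).1)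
    (fun x y hne hxy => paleyGraph_adj_of_crt_fst_eq hs3 hcop hm x y hne hxy) ht
  calc _ ≤ (Fintype.card (ZMod 3) : ℝ) := h
    _ = 3 := by norm_num [ZMod.card]

/-! #### Isomorphism invariance of `las⁽ᵗ⁾` and self-complementarity of `P_p` -/

/-- `las⁽ᵗ⁾` is monotone along graph isomorphisms (pull back a feasible `y` of `G'` to
`S ↦ y (φ '' S)`; the moment matrix becomes a reindexing). [folklore] -/
theorem lasserreStableBound_le_of_iso {V W : Type*} [Fintype V] [DecidableEq V] [Fintype W]
    [DecidableEq W] {G : SimpleGraph V} {G' : SimpleGraph W} (φ : G ≃g G') {t : ℕ} (ht : 1 ≤ t) :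
    lasserreStableBound G' t ≤ lasserreStableBound G t := by
  refine lasserreStableBound_le_of_forall fun y hy => ?_
  set y' : Finset V → ℝ := fun S => y (S.map φ.toEquiv.toEmbedding) with hy'def
  have hy' : IsLasserreFeasible G t y' := by
    refine ⟨?_, ?_, ?_⟩
    · simp [hy'def, hy.empty_eq_one]
    · intro u v huv
      simp only [hy'def, Finset.map_insert, Finset.map_singleton, Equiv.coe_toEmbedding]
      exact hy.pair_eq_zero (φ.map_adj_iff.2 huv)
    · have hM : momentMatrix t y' = (momentMatrix t y).submatrix
          (fun I : {S : Finset V // S.card ≤ t} =>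
            (⟨I.1.map φ.toEquiv.toEmbedding, by rw [Finset.card_map]; exact I.2⟩ :
              {S : Finset W // S.card ≤ t}))
          (fun I => ⟨I.1.map φ.toEquiv.toEmbedding, by rw [Finset.card_map]; exact I.2⟩) := by
        ext I J
        simp [momentMatrix_apply, hy'def, Finset.map_union]
      rw [hM]
      exact hy.posSemidef.submatrix _
  have hval : ∑ v, y' {v} = ∑ w, y {w} := by
    simp only [hy'def, Finset.map_singleton, Equiv.coe_toEmbedding]
    exact φ.toEquiv.sum_comp (fun w => y {w})
  rw [← hval]
  exact hy'.sum_singleton_le_lasserreStableBound ht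

/-- `las⁽ᵗ⁾` is an isomorphism invariant (`t ≥ 1`). [folklore] -/
theorem lasserreStableBound_eq_of_iso {V W : Type*} [Fintype V] [DecidableEq V] [Fintype W]
    [DecidableEq W] {G : SimpleGraph V} {G' : SimpleGraph W} (φ : G ≃g G') {t : ℕ} (ht : 1 ≤ t) :
    lasserreStableBound G t = lasserreStableBound G' t :=
  le_antisymm (lasserreStableBound_le_of_iso φ.symm ht) (lasserreStableBound_le_of_iso φ ht)

/-- **Self-complementarity of the Paley graph** (`x ↦ g x`, `g` a non-residue, maps edges to
non-edges: `χ(g(x − y)) = −χ(x − y)`). [cite: KuniskyYu2022, Proposition 2.6] -/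
theorem nonempty_iso_compl_paleyGraph (n : ℕ) [Fact (n + 1).Prime] (h4 : (n + 1) % 4 = 1) :
    Nonempty (paleyGraph (n + 1) ≃g (paleyGraph (n + 1))ᶜ) := by
  obtain ⟨g, hg⟩ := quadraticChar_exists_neg_one (ringChar_zmod_ne_two h4)
  have hg0 : g ≠ 0 := by
    rintro rfl
    simp at hg
  have key : ∀ x y : ZMod (n + 1),
      (paleyGraph (n + 1))ᶜ.Adj (g * x) (g * y) ↔ (paleyGraph (n + 1)).Adj x y := by
    intro x y
    change (g * x ≠ g * y ∧ ¬ (paleyGraph (n + 1)).Adj (g * x) (g * y)) ↔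
      (paleyGraph (n + 1)).Adj x y
    have hinj : g * x ≠ g * y ↔ x ≠ y := (mul_right_injective₀ hg0).ne_iff
    have hmul : quadraticChar (ZMod (n + 1)) (g * x - g * y) =
        -quadraticChar (ZMod (n + 1)) (x - y) := by
      rw [← mul_sub, map_mul, hg, neg_one_mul]
    rw [paleyGraph_adj_iff_quadraticChar n h4, paleyGraph_adj_iff_quadraticChar n h4, hinj, hmul]
    constructor
    · rintro ⟨hne, h⟩
      refine ⟨hne, ?_⟩
      have hd : x - y ≠ 0 := sub_ne_zero.2 hne
      rcases quadraticChar_dichotomy hd with h1 | h1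
      · exact h1
      · exact absurd ⟨hne, by rw [h1]; norm_num⟩ h
    · rintro ⟨hne, h⟩
      refine ⟨hne, fun h' => ?_⟩
      have h'' := h'.2
      rw [h] at h''
      norm_num at h''
  exact ⟨⟨(Equiv.mulLeft₀ g hg0 :), fun {a b} => key a b⟩⟩

/-- `las⁽ᵗ⁾(P̄_p) = las⁽ᵗ⁾(P_p)` (`t ≥ 1`): the transport the `t = 2` rung needs from the vendored
Kunisky–Yu fact (stated for the complement). [folklore] -/
theorem lasserreStableBound_compl_paleyGraph {p : ℕ} (hp : p.Prime) (h4 : p % 4 = 1) {t : ℕ}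
    (ht : 1 ≤ t) :
    lasserreStableBound (paleyGraph p)ᶜ t = lasserreStableBound (paleyGraph p) t := by
  obtain ⟨n, rfl⟩ : ∃ n, p = n + 1 := ⟨p - 1, (Nat.succ_pred_eq_of_pos hp.pos).symm⟩
  haveI : Fact (n + 1).Prime := ⟨hp⟩
  obtain ⟨φ⟩ := nonempty_iso_compl_paleyGraph n h4
  exact (lasserreStableBound_eq_of_iso φ ht).symm

end Paley

/-! ### (0) What a disproof would prove -/

/-- **Reduction.** A disproof of the crux exhibits, for EVERY `η > 0`, infinitely many primes
`p ≡ 1 (mod 4)` with `α(P_p) < p^η` (`α ≤ las⁽ᵗ⁾`, soundness): i.e. it certifies that the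
independence (= clique, by self-complementarity) number of prime-order Paley graphs is `p^{o(1)}`
along an infinite sequence — far beyond the best proved bound `(√(2p−1)+1)/2` (Hanson–Petridis
2021). This is WHY the crux resists cheap refutation. [folklore] -/
theorem indepNum_lt_of_not_paleySosRung (h : ¬ PaleySosRung) {η : ℝ} (hη : 0 < η) (p₀ : ℕ) :
    ∃ p ≥ p₀, p.Prime ∧ p % 4 = 1 ∧ ((paleyGraph p).indepNum : ℝ) < (p : ℝ) ^ η := by
  unfold PaleySosRung at h
  push Not at h
  obtain ⟨t, ht, h⟩ := h
  obtain ⟨p, hp₀, hp, h4, hlt⟩ := h η hη p₀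
  exact ⟨p, hp₀, hp, h4, (indepNum_le_lasserreStableBound _ t ht).trans_lt hlt⟩


/-- The independence number is invariant under graph isomorphisms (`≤` half). [folklore] -/
theorem indepNum_le_of_iso {V W : Type*} [Fintype V] [DecidableEq V] [Fintype W] [DecidableEq W]
    {G : SimpleGraph V} {G' : SimpleGraph W} (φ : G ≃g G') : G.indepNum ≤ G'.indepNum := by
  obtain ⟨s, hs⟩ := G.exists_isNIndepSet_indepNum
  rw [← hs.card_eq, ← Finset.card_map φ.toEquiv.toEmbedding]
  refine SimpleGraph.IsIndepSet.card_le_indepNum ?_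
  intro x hx y hy hxy
  rw [mem_coe, Finset.mem_map] at hx hy
  obtain ⟨a, ha, rfl⟩ := hx
  obtain ⟨b, hb, rfl⟩ := hy
  have hab : a ≠ b := fun h => hxy (by rw [h])
  show ¬ G'.Adj (φ a) (φ b)
  rw [φ.map_adj_iff]
  exact hs.isIndepSet (mem_coe.2 ha) (mem_coe.2 hb) hab

/-- `ω(P_p) = α(P_p)` for primes `p ≡ 1 (mod 4)` (self-complementarity). [folklore] -/
theorem cliqueNum_paleyGraph_eq_indepNum {p : ℕ} (hp : p.Prime) (h4 : p % 4 = 1) :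
    (paleyGraph p).cliqueNum = (paleyGraph p).indepNum := by
  obtain ⟨n, rfl⟩ : ∃ n, p = n + 1 := ⟨p - 1, (Nat.succ_pred_eq_of_pos hp.pos).symm⟩
  haveI : Fact (n + 1).Prime := ⟨hp⟩
  obtain ⟨φ⟩ := nonempty_iso_compl_paleyGraph n h4
  rw [← SimpleGraph.indepNum_compl]
  exact le_antisymm (indepNum_le_of_iso φ.symm) (indepNum_le_of_iso φ)

/-- **Reduction, clique form**: a disproof of the crux proves `ω(P_p) < p^η` for every `η > 0` along
an infinite sequence of primes `p ≡ 1 (mod 4)` — the open problem of breaking the `√p` barrier for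
the clique number of Paley graphs, in its strongest conceivable form short of Conjecture 1.1
(`ω(P_p) = O(polylog p)`, Kunisky–Yu p. 4). [folklore] -/
theorem cliqueNum_lt_of_not_paleySosRung (h : ¬ PaleySosRung) {η : ℝ} (hη : 0 < η) (p₀ : ℕ) :
    ∃ p ≥ p₀, p.Prime ∧ p % 4 = 1 ∧ ((paleyGraph p).cliqueNum : ℝ) < (p : ℝ) ^ η := by
  obtain ⟨p, hp₀, hp, h4, hlt⟩ := indepNum_lt_of_not_paleySosRung h hη p₀
  exact ⟨p, hp₀, hp, h4, by rwa [cliqueNum_paleyGraph_eq_indepNum hp h4]⟩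

/-- **A disproof of this crux kills crux #2 (`SosUncertainty`, UP_t) as well**: UP_t at `G = P_p`
gives `p^δ ≤ las⁽ᵗ⁾(P_p)·las⁽ᵗ⁾(P̄_p) = las⁽ᵗ⁾(P_p)²` (self-complementarity + isomorphism invariance,
above), so the crux holds with `η = δ/2`. This is the route's `[deps: SosUncertainty]`, proved.
[folklore] -/
theorem paleySosRung_of_sosUncertainty (h : SosUncertainty) : PaleySosRung := by
  intro t ht
  obtain ⟨δ, hδ, n₀, hn₀⟩ := h t ht
  refine ⟨δ / 2, by positivity, n₀, fun p hp₀ hp h4 => ?_⟩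
  have h1 := hn₀ p hp₀ (SimpleGraph.fromRel fun x y : Fin p => IsSquare (x - y))
  rw [← paleyGraph_eq_fromRel] at h1 ⊢
  rw [lasserreStableBound_compl_paleyGraph hp h4 ht] at h1
  have h0 : 0 ≤ lasserreStableBound (paleyGraph p) t := lasserreStableBound_nonneg _ _ ht
  have hsq : ((p : ℝ) ^ (δ / 2)) * ((p : ℝ) ^ (δ / 2)) = (p : ℝ) ^ δ := by
    rw [← Real.rpow_add_of_nonneg (Nat.cast_nonneg p) (by positivity) (by positivity)]
    ring_nf
  by_contra hlt
  push Not at hlt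
  have h2 := mul_self_lt_mul_self h0 hlt
  rw [hsq] at h2
  linarith

/-- Contrapositive, for the record: `¬ PaleySosRung → ¬ SosUncertainty`. [folklore] -/
theorem not_sosUncertainty_of_not_paleySosRung (h : ¬ PaleySosRung) : ¬ SosUncertainty :=
  fun hs => h (paleySosRung_of_sosUncertainty hs)

/-- **The `t = 2` rung from the vendored Kunisky–Yu fact** (`kuniskyYu2022_theorem_1_2`:
`c·p^{1/3} ≤ las⁽²⁾(P̄_p)`), transported along self-complementarity: the level-`2` instance of the
crux holds with `η = 1/6` (any `η < 1/3` would do). So levels `t ≤ 2` are settled modulo that fact;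
the live content of the crux is `t ≥ 3`. [cite: KuniskyYu2022, Theorem 1.2] -/
theorem paleySosRung_level_two_of_kuniskyYu (hKY : kuniskyYu2022_theorem_1_2) :
    ∃ η : ℝ, 0 < η ∧ ∃ p₀ : ℕ, ∀ p ≥ p₀, p.Prime → p % 4 = 1 →
      (p : ℝ) ^ η ≤ lasserreStableBound (SimpleGraph.fromRel fun x y : Fin p => IsSquare (x - y)) 2 := by
  obtain ⟨c, hc, hKY⟩ := hKY
  refine ⟨1 / 6, by norm_num, ⌈(1 / c) ^ (6 : ℕ)⌉₊, fun p hp₀ hp h4 => ?_⟩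
  rw [← paleyGraph_eq_fromRel, ← lasserreStableBound_compl_paleyGraph hp h4 (by norm_num)]
  refine le_trans ?_ (hKY p hp h4)
  have hp0 : (0 : ℝ) ≤ p := Nat.cast_nonneg p
  have hsix : 0 ≤ (p : ℝ) ^ (1 / 6 : ℝ) := Real.rpow_nonneg hp0 _
  have hthird : (p : ℝ) ^ (1 / 3 : ℝ) = (p : ℝ) ^ (1 / 6 : ℝ) * (p : ℝ) ^ (1 / 6 : ℝ) := by
    rw [← Real.rpow_add_of_nonneg hp0 (by norm_num) (by norm_num)]
    norm_num
  -- `(1/c)^6 ≤ p` gives `1/c ≤ p^{1/6}`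
  have hbase : (1 / c) ^ (6 : ℕ) ≤ (p : ℝ) := (Nat.le_ceil _).trans (by exact_mod_cast hp₀)
  have hroot : 1 / c ≤ (p : ℝ) ^ (1 / 6 : ℝ) := by
    have h1 : ((1 / c) ^ (6 : ℕ)) ^ (1 / 6 : ℝ) ≤ (p : ℝ) ^ (1 / 6 : ℝ) :=
      Real.rpow_le_rpow (by positivity) hbase (by norm_num)
    rwa [← Real.rpow_natCast, ← Real.rpow_mul (by positivity), show ((6 : ℕ) : ℝ) * (1 / 6) = 1 by
      norm_num, Real.rpow_one] at h1
  rw [hthird]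
  calc (p : ℝ) ^ (1 / 6 : ℝ) = c * (1 / c) * (p : ℝ) ^ (1 / 6 : ℝ) := by
        rw [mul_one_div_cancel hc.ne', one_mul]
    _ ≤ c * (p : ℝ) ^ (1 / 6 : ℝ) * (p : ℝ) ^ (1 / 6 : ℝ) := by
        rw [mul_assoc, mul_assoc]
        exact mul_le_mul_of_nonneg_left (mul_le_mul_of_nonneg_right hroot hsix) hc.le
    _ = c * ((p : ℝ) ^ (1 / 6 : ℝ) * (p : ℝ) ^ (1 / 6 : ℝ)) := by ring

/-! ### (a) Load-bearing hypotheses -/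

/-- The crux with the level restriction `1 ≤ t` dropped. -/
def PaleySosRungWithoutLevelPos : Prop :=
  ∀ t : ℕ, ∃ η : ℝ, 0 < η ∧ ∃ p₀ : ℕ, ∀ p ≥ p₀, p.Prime → p % 4 = 1 →
    (p : ℝ) ^ η ≤ lasserreStableBound (SimpleGraph.fromRel fun x y : Fin p => IsSquare (x - y)) t

/-- **Any proof must use `1 ≤ t`**: at level `0` the bound is the junk value `0 < p^η`. [folklore] -/
theorem paleySosRung_false_without_levelPos : ¬ PaleySosRungWithoutLevelPos := by
  intro h
  obtain ⟨η, _hη, p₀, hp₀⟩ := h 0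
  obtain ⟨p, hp, hgt, hmod⟩ := Nat.exists_prime_gt_modEq_one p₀ (by norm_num : (4 : ℕ) ≠ 0)
  have h1 := hp₀ p hgt.le hp hmod
  rw [← paleyGraph_eq_fromRel, lasserreStableBound_zero] at h1
  have h2 : (0 : ℝ) < (p : ℝ) ^ η := Real.rpow_pos_of_pos (by exact_mod_cast hp.pos) η
  linarith

/-- The crux with the congruence `p ≡ 1 (mod 4)` dropped. -/
def PaleySosRungWithoutModFour : Prop :=
  ∀ t : ℕ, 1 ≤ t → ∃ η : ℝ, 0 < η ∧ ∃ p₀ : ℕ, ∀ p ≥ p₀, p.Prime →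
    (p : ℝ) ^ η ≤ lasserreStableBound (SimpleGraph.fromRel fun x y : Fin p => IsSquare (x - y)) t

/-- **Any proof must use `p ≡ 1 (mod 4)`**: for the (infinitely many, Dirichlet) primes
`p ≡ 3 (mod 4)` the symmetrised graph is `K_p` and `las⁽ᵗ⁾(K_p) ≤ 1 < p^η`. [folklore] -/
theorem paleySosRung_false_without_modFour : ¬ PaleySosRungWithoutModFour := by
  intro h
  obtain ⟨η, hη, p₀, hp₀⟩ := h 1 le_rfl
  obtain ⟨p, hgt, hp, hmod⟩ :=
    Nat.forall_exists_prime_gt_and_eq_mod (q := 4) (a := 3) (by decide) p₀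
  have h3 : p % 4 = 3 := by
    have := (ZMod.natCast_eq_natCast_iff' p 3 4).1 (by simpa using hmod)
    simpa using this
  obtain ⟨m, rfl⟩ : ∃ m, p = m + 1 := ⟨p - 1, (Nat.succ_pred_eq_of_pos hp.pos).symm⟩
  haveI : Fact (m + 1).Prime := ⟨hp⟩
  have h1 := hp₀ (m + 1) hgt.le hp
  rw [← paleyGraph_eq_fromRel, paleyGraph_eq_top_of_mod_four_eq_three m h3] at h1
  have h2 := lasserreStableBound_top_le_one (V := Fin (m + 1)) (le_refl 1)
  have h3' : (1 : ℝ) < ((m + 1 : ℕ) : ℝ) ^ η :=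
    Real.one_lt_rpow (by exact_mod_cast hp.one_lt) hη
  linarith

/-- The crux with PRIMALITY dropped (all moduli `p ≡ 1 (mod 4)`, arithmetic in `ℤ/pℤ = Fin p`). -/
def PaleySosRungWithoutPrime : Prop :=
  ∀ t : ℕ, 1 ≤ t → ∃ η : ℝ, 0 < η ∧ ∃ p₀ : ℕ, ∀ p ≥ p₀, p % 4 = 1 →
    (p : ℝ) ^ η ≤ lasserreStableBound (SimpleGraph.fromRel fun x y : Fin p => IsSquare (x - y)) t

/-- **Any proof must use primality (the field structure)**: along the composite moduli
`p = 3s ≡ 1 (mod 4)`, `s ≡ 3 (mod 4)` prime (`p = 21, 33, 57, 69, 93, …`; infinitely many by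
Dirichlet), the graph is covered by `3` cliques and `las⁽ᵗ⁾ ≤ 3 < p^η`. The statement is NOT a
generic property of square-difference Cayley graphs of cyclic groups. [folklore] -/
theorem paleySosRung_false_without_prime : ¬ PaleySosRungWithoutPrime := by
  intro h
  obtain ⟨η, hη, p₀, hp₀⟩ := h 1 le_rfl
  obtain ⟨s, hgt, hs, hmod⟩ := Nat.forall_exists_prime_gt_and_eq_mod (q := 4) (a := 3) (by decide)
    (max p₀ (max 3 ⌈(3 : ℝ) ^ (1 / η)⌉₊))
  have hs3 : s % 4 = 3 := by
    have := (ZMod.natCast_eq_natCast_iff' s 3 4).1 (by simpa using hmod)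
    simpa using this
  have hs_p₀ : p₀ < s := lt_of_le_of_lt (le_max_left _ _) hgt
  have hs_3 : 3 < s := lt_of_le_of_lt ((le_max_left _ _).trans (le_max_right _ _)) hgt
  have hs_ceil : ⌈(3 : ℝ) ^ (1 / η)⌉₊ < s :=
    lt_of_le_of_lt ((le_max_right _ _).trans (le_max_right _ _)) hgt
  haveI : Fact s.Prime := ⟨hs⟩
  obtain ⟨m, hm⟩ : ∃ m, m + 1 = 3 * s := ⟨3 * s - 1, by omega⟩
  have hcop : Nat.Coprime 3 s := (Nat.coprime_primes (by norm_num) hs).2 (by omega)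
  have h1 := hp₀ (m + 1) (by omega) (by omega)
  rw [← paleyGraph_eq_fromRel] at h1
  have h2 : lasserreStableBound (paleyGraph (m + 1)) 1 ≤ 3 :=
    lasserreStableBound_paleyGraph_three_mul_le hs3 hcop hm le_rfl
  have h3 : (3 : ℝ) < ((m + 1 : ℕ) : ℝ) ^ η := by
    have hbase : (3 : ℝ) ^ (1 / η) < ((m + 1 : ℕ) : ℝ) := by
      calc (3 : ℝ) ^ (1 / η) ≤ ⌈(3 : ℝ) ^ (1 / η)⌉₊ := Nat.le_ceil _
        _ < s := by exact_mod_cast hs_ceil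
        _ ≤ ((m + 1 : ℕ) : ℝ) := by exact_mod_cast (by omega : s ≤ m + 1)
    calc (3 : ℝ) = ((3 : ℝ) ^ (1 / η)) ^ η := by
          rw [← Real.rpow_mul (by norm_num), one_div_mul_cancel hη.ne', Real.rpow_one]
      _ < ((m + 1 : ℕ) : ℝ) ^ η := Real.rpow_lt_rpow (by positivity) hbase hη
  linarith

/-! #### The threshold `p₀` is NOT load-bearing -/

/-- `α(P_p) ≥ 2`, hence `las⁽ᵗ⁾(P_p) ≥ 2` (`t ≥ 1`): `0` and a quadratic non-residue `a` are
non-adjacent (`−a` is a non-residue too, `−1` being a square). [folklore] -/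
theorem two_le_lasserreStableBound_paleyGraph {p : ℕ} (hp : p.Prime) (h4 : p % 4 = 1) {t : ℕ}
    (ht : 1 ≤ t) : (2 : ℝ) ≤ lasserreStableBound (paleyGraph p) t := by
  obtain ⟨n, rfl⟩ : ∃ n, p = n + 1 := ⟨p - 1, (Nat.succ_pred_eq_of_pos hp.pos).symm⟩
  haveI : Fact (n + 1).Prime := ⟨hp⟩
  obtain ⟨a, ha⟩ := quadraticChar_exists_neg_one (ringChar_zmod_ne_two h4)
  have ha0 : a ≠ 0 := by
    rintro rfl
    simp at ha
  have hna : ¬ IsSquare a := quadraticChar_neg_one_iff_not_isSquare.1 ha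
  -- view the Paley graph on the vertex type `ZMod (n + 1)` (definitionally `Fin (n + 1)`)
  set G' : SimpleGraph (ZMod (n + 1)) := paleyGraph (n + 1) with hG'
  have hnadj : ¬ G'.Adj 0 a := by
    rw [hG', paleyGraph_adj_iff_isSquare n h4]
    rintro ⟨-, hsq⟩
    rw [zero_sub] at hsq
    have h2 := hsq.mul (isSquare_neg_one_zmod h4)
    rw [neg_mul_neg, mul_one] at h2
    exact hna h2
  have hind : G'.IsNIndepSet 2 {0, a} := by
    refine ⟨?_, card_pair (Ne.symm ha0)⟩
    rw [SimpleGraph.IsIndepSet, coe_pair, Set.pairwise_pair]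
    exact fun _ => ⟨hnadj, fun h => hnadj h.symm⟩
  have h := le_lasserreStableBound_of_isNIndepSet G' t hind ht
  have hGG : lasserreStableBound G' t = lasserreStableBound (paleyGraph (n + 1)) t := by
    rw [hG']
    rfl
  rw [hGG] at h
  exact_mod_cast h

/-- **`p₀` is cosmetic**: the crux is equivalent to its `p₀`-free form (shrink `η` so that
`p^η ≤ 2 ≤ α(P_p) ≤ las⁽ᵗ⁾(P_p)` for the finitely many `p < p₀`). Information for provers: the
threshold carries no content. [folklore] -/
theorem paleySosRung_iff_forall_prime :
    PaleySosRung ↔ ∀ t : ℕ, 1 ≤ t → ∃ η : ℝ, 0 < η ∧ ∀ p : ℕ, p.Prime → p % 4 = 1 →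
      (p : ℝ) ^ η ≤ lasserreStableBound (SimpleGraph.fromRel fun x y : Fin p => IsSquare (x - y)) t := by
  constructor
  · intro h t ht
    obtain ⟨η, hη, p₀, hp₀⟩ := h t ht
    set b : ℝ := (p₀ : ℝ) + 2 with hb
    have hb1 : 1 < b := by rw [hb]; have : (0 : ℝ) ≤ p₀ := Nat.cast_nonneg _; linarith
    set L : ℝ := Real.logb b 2 with hL
    have hL0 : 0 < L := Real.logb_pos hb1 one_lt_two
    refine ⟨min η L, lt_min hη hL0, fun p hp h4 => ?_⟩
    rw [← paleyGraph_eq_fromRel]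
    have hp1 : (1 : ℝ) ≤ p := by exact_mod_cast hp.one_lt.le
    rcases le_or_gt p₀ p with hle | hlt
    · have h1 := hp₀ p hle hp h4
      rw [← paleyGraph_eq_fromRel] at h1
      exact (Real.rpow_le_rpow_of_exponent_le hp1 (min_le_left _ _)).trans h1
    · calc (p : ℝ) ^ min η L ≤ (p : ℝ) ^ L :=
            Real.rpow_le_rpow_of_exponent_le hp1 (min_le_right _ _)
        _ ≤ b ^ L := by
            refine Real.rpow_le_rpow (by positivity) ?_ hL0.le
            rw [hb]
            have : (p : ℝ) ≤ p₀ := by exact_mod_cast hlt.le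
            linarith
        _ = 2 := Real.rpow_logb (by linarith) hb1.ne' two_pos
        _ ≤ lasserreStableBound (paleyGraph p) t := two_le_lasserreStableBound_paleyGraph hp h4 ht
  · intro h t ht
    obtain ⟨η, hη, h⟩ := h t ht
    exact ⟨η, hη, 0, fun p _ hp h4 => h p hp h4⟩

/-! ### (b) Tightness: the level-1 rung holds with `η = 1/2`, and no level allows `η > 1/2` -/

/-- The `t = 1` instance of the crux HOLDS with `η = 1/2`, `p₀ = 0` (tree:
`sqrt_le_lasserreStableBound_paleyGraph_one`). [cite: Lovasz1979, Theorem 8] -/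
theorem paleySosRung_level_one : ∃ η : ℝ, 0 < η ∧ ∃ p₀ : ℕ, ∀ p ≥ p₀, p.Prime → p % 4 = 1 →
    (p : ℝ) ^ η ≤ lasserreStableBound (SimpleGraph.fromRel fun x y : Fin p => IsSquare (x - y)) 1 :=
  ⟨1 / 2, by norm_num, 0, fun p _ hp h4 => by
    rw [← Real.sqrt_eq_rpow]
    exact sqrt_le_lasserreStableBound_paleyGraph_one hp h4⟩

/-- **Exponent ceiling**: at ANY level `t ≥ 1`, an exponent `η` that works eventually satisfies
`η ≤ 1/2` (since `las⁽ᵗ⁾(P_p) ≤ ϑ(P_p) = √p`). So `η = 1/2` at `t = 1` cannot be improved, and the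
conjectured truth (Kunisky–Yu numerics `≈ p^{0.45}` at `t = 2`) lies strictly inside `(0, 1/2]`.
[folklore] -/
theorem exponent_le_half {t : ℕ} (ht : 1 ≤ t) {η : ℝ}
    (h : ∃ p₀ : ℕ, ∀ p ≥ p₀, p.Prime → p % 4 = 1 →
      (p : ℝ) ^ η ≤ lasserreStableBound (SimpleGraph.fromRel fun x y : Fin p => IsSquare (x - y)) t) :
    η ≤ 1 / 2 := by
  obtain ⟨p₀, hp₀⟩ := h
  by_contra hη
  push Not at hη
  obtain ⟨p, hp, hgt, hmod⟩ := Nat.exists_prime_gt_modEq_one p₀ (by norm_num : (4 : ℕ) ≠ 0)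
  have h1 := hp₀ p hgt.le hp hmod
  rw [← paleyGraph_eq_fromRel] at h1
  have h2 := lasserreStableBound_paleyGraph_le_sqrt hp hmod ht
  rw [Real.sqrt_eq_rpow] at h2
  have hp1 : (1 : ℝ) < p := by exact_mod_cast hp.one_lt
  have h3 : (p : ℝ) ^ (1 / 2 : ℝ) < (p : ℝ) ^ η := (Real.rpow_lt_rpow_left_iff hp1).2 hη
  linarith

/-! ### (c) Natural strengthenings refuted -/

/-- Strengthening: the level-1 value `√p` persists at every level and every prime (no `p₀`, no loss
in the exponent). -/
def PaleySosRungSqrtAllLevels : Prop :=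
  ∀ t : ℕ, 1 ≤ t → ∀ p : ℕ, p.Prime → p % 4 = 1 →
    Real.sqrt p ≤ lasserreStableBound (SimpleGraph.fromRel fun x y : Fin p => IsSquare (x - y)) t

/-- **Refuted** at `t = 2`, `p = 5`: `P_5 = C_5`, `α(C_5) = 2`, and by finite convergence
(Laurent 2003, tree: `Laurent2003_lasserre_exact_of_indepNum_le_holds`) `las⁽²⁾(C_5) = 2 < √5`.
The hierarchy DOES drop below `√p` at fixed `p`; the crux is only about the exponent as `p → ∞`.
[folklore] -/
theorem not_paleySosRungSqrtAllLevels : ¬ PaleySosRungSqrtAllLevels := by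
  intro h
  have h1 := h 2 (by norm_num) 5 (by norm_num) (by norm_num)
  rw [← paleyGraph_eq_fromRel] at h1
  have hα : (paleyGraph 5).indepNum ≤ 2 := indepNum_paleyGraph_five_le
  have heq := lasserreStableBound_eq_indepNum Laurent2003_lasserre_exact_of_indepNum_le_holds
    (paleyGraph 5) (by norm_num : 1 ≤ 2) hα
  rw [heq] at h1
  have h2 : ((paleyGraph 5).indepNum : ℝ) ≤ 2 := by exact_mod_cast hα
  have h3 : (2 : ℝ) < Real.sqrt ((5 : ℕ) : ℝ) := by
    rw [show ((5 : ℕ) : ℝ) = 5 by norm_num, Real.lt_sqrt (by norm_num)]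
    norm_num
  linarith

/-- **At every prime the hierarchy eventually drops strictly below `√p`**: for `t ≥ p`, finite
convergence gives `las⁽ᵗ⁾(P_p) = α(P_p)`, and `α(P_p) < √p` because `α(P_p) ≤ las⁽¹⁾(P_p) = √p` and
`α(P_p)² = p` is impossible for a prime. [folklore] -/
theorem lasserreStableBound_paleyGraph_lt_sqrt_of_card_le {p : ℕ} (hp : p.Prime)
    (h4 : p % 4 = 1) {t : ℕ} (hpt : p ≤ t) :
    lasserreStableBound (paleyGraph p) t < Real.sqrt p := by
  have ht : 1 ≤ t := hp.one_lt.le.trans hpt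
  have hα : (paleyGraph p).indepNum ≤ t := by
    refine le_trans ?_ hpt
    obtain ⟨s, hs⟩ := (paleyGraph p).exists_isNIndepSet_indepNum
    rw [← hs.card_eq]
    exact (card_le_univ s).trans (Fintype.card_fin p).le
  rw [lasserreStableBound_eq_indepNum Laurent2003_lasserre_exact_of_indepNum_le_holds
    (paleyGraph p) ht hα]
  have hle : ((paleyGraph p).indepNum : ℝ) ≤ Real.sqrt p :=
    (indepNum_le_lasserreStableBound (paleyGraph p) 1 le_rfl).trans
      (lasserreStableBound_paleyGraph_le_sqrt hp h4 le_rfl)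
  refine lt_of_le_of_ne hle fun heq => ?_
  -- `α² = p` contradicts primality
  have hsq : ((paleyGraph p).indepNum : ℝ) ^ 2 = p := by
    rw [heq, Real.sq_sqrt (Nat.cast_nonneg p)]
  have hnat : (paleyGraph p).indepNum * (paleyGraph p).indepNum = p := by
    exact_mod_cast (show ((paleyGraph p).indepNum : ℝ) * (paleyGraph p).indepNum = p by
      rw [← sq, hsq])
  have hdvd : (paleyGraph p).indepNum ∣ p := ⟨_, hnat.symm⟩
  rcases (Nat.dvd_prime hp).1 hdvd with h1 | h1
  · rw [h1, one_mul] at hnat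
    exact hp.one_lt.ne hnat
  · rw [h1] at hnat
    have : p * p ≤ p * 1 := by rw [mul_one]; exact hnat.le
    have := Nat.le_of_mul_le_mul_left this hp.pos
    exact absurd this (not_le.2 hp.one_lt)

/-- Strengthening: `√p ≤ las⁽ᵗ⁾(P_p)` for all levels beyond ONE threshold `p₀` uniform in `t`. -/
def PaleySosRungSqrtEventually : Prop :=
  ∃ p₀ : ℕ, ∀ t : ℕ, 1 ≤ t → ∀ p ≥ p₀, p.Prime → p % 4 = 1 →
    Real.sqrt p ≤ lasserreStableBound (SimpleGraph.fromRel fun x y : Fin p => IsSquare (x - y)) t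

/-- **Refuted** (uniformly, not just at `p = 5`): given `p₀`, take any prime `p ≥ p₀`, `p ≡ 1 (4)`
and the level `t = p`. So no threshold rescues the level-`1` value `√p` across levels: whatever is
true at fixed `t ≥ 2` must lose in the exponent or in the constant. [folklore] -/
theorem not_paleySosRungSqrtEventually : ¬ PaleySosRungSqrtEventually := by
  rintro ⟨p₀, h⟩
  obtain ⟨p, hp, hgt, hmod⟩ := Nat.exists_prime_gt_modEq_one p₀ (by norm_num : (4 : ℕ) ≠ 0)
  have h1 := h p hp.one_lt.le p hgt.le hp hmod
  rw [← paleyGraph_eq_fromRel] at h1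
  exact absurd h1 (not_le.2 (lasserreStableBound_paleyGraph_lt_sqrt_of_card_le hp hmod le_rfl))

end

end Summit.PneNP.PneNP.Cruxes.PaleySosRung.Disproof
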